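import Summits.ValiantsHypothesis.ValiantsHypothesis.Theses.BarrierLever
import Summits.ValiantsHypothesis.ValiantsHypothesis.Theorems.BarrierLeverTransversalTwinFreeReduction

/-!
# Route BarrierLever — item `TransversalTwinFreeReduction` (R2, stmt-ValiantsHypothesis-19588):
# the link

Closing link (`--workitem stmt-ValiantsHypothesis-19588`; cell valiant-natproofs, rung V4; prover
seat val-np-p1). The proof is `LiteralLift.transversalTwinFreeReduction`
(`Theorems/BarrierLeverTransversalTwinFreeReduction.lean`, item signature verbatim, by the
literal-block lift); this file only restates it with the route declaration
`Theses.BarrierLever.TransversalTwinFreeReduction` as its type, so that the gate's type-match closes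
the item (this module imports the route file, hence no `_holds` link there).

WHAT THIS IS NOT: one algebraic reduction step for TT (item 19152); nothing on the irreducible
core (item 19616), TT / TNS / item 19717 in general, crux stmt-ValiantsHypothesis-14610, or `VP`
versus `VNP`.
-/

-- layout Summits/ValiantsHypothesis/ValiantsHypothesis forces the duplicated namespace component
set_option linter.dupNamespace false

namespace Summit.ValiantsHypothesis.ValiantsHypothesis.Theorems.BarrierLever.LiteralLift

/-- **Item stmt-ValiantsHypothesis-19588 `TransversalTwinFreeReduction` (R2) holds** (typed by the
route declaration; proof `transversalTwinFreeReduction`). -/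
theorem transversalTwinFreeReduction_route :
    Summit.ValiantsHypothesis.ValiantsHypothesis.Theses.BarrierLever.TransversalTwinFreeReduction :=
  transversalTwinFreeReduction

end Summit.ValiantsHypothesis.ValiantsHypothesis.Theorems.BarrierLever.LiteralLift
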